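import Summits.CriticalPhenomena.PercolationContinuityZ3.Theorems.PercAnnulusCrossingSlabMSFScales
import Summits.CriticalPhenomena.PercolationContinuityZ3.Theorems.PercAnnulusCrossingInvasionLocalityEdges
import Literature.Probability.Percolation.SlabMSFNoNewCircuit
import Literature.Probability.Percolation.SlabMSFRenewal
import HarnessLib

/-!
# RSW3 lane (P1, gen 34): NTW 2017 §4 — MEASURABILITY AND LOCALITY OF THE GLUING EVENTS
# (`Γ_min(η(U))`, the stopped invasions `𝓘_0^m`, `𝓘_x^m`, the surgered configurations, as functions of the labels)

builds on p205010 (kernel theorem, internal audit signed; external expert review pending) — NOT used in this file.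

Cell `prim-rsw3`, prover seat `prim-rsw3-p1` (gen 34), build-out blueprint `prim-rsw3-lead/gen44/BUILDOUT-PLAN.md` §4
(measurability half of F7) and §5 (`𝓩^j ∈ σ(U|F_j)`) of the sequel NTW 2017 Thm 2.4.  Support file
(`--supports stmt-CriticalPhenomena-4575`); no definitions, no named facts, no sorries.

Newman–Tassion–Wu (arXiv:1512.09107, p. 19): «Since `𝓩^{i-1}` is measurable with respect to the state of edges in
`B̄_{m_{i-1}}` …», where `𝓩^i = 𝓑_0^{m_i} ∩ 𝓑_x^{m_i} ∩ C_{n_i,2n_i}` and `𝓑_x^m = {V(Γ_min) ⊆ 𝓘_x^m}`: every event of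
the gluing argument is a function of the TRIPLE `(Γ_min(η_{p_c}(U)), 𝓘_0^{Λ}(U), 𝓘_x^{Λ}(U))` (minimal circuit of the
configuration at level `p`, the two invasions stopped at their break-out of the column box `Λ`), and the pieces of the
surgery are indexed by `Γ_min`, the landing vertices (break-out vertices of `Γ_min`-dependent sets) and a connection test
in the surgered configuration `cfgZ`.  This file supplies, on the label space `(Sym2 (slab 3 k) → ℝ, labelMeasure)`:

* FIBRE LEMMAS (`measurable_of_fibres` and its instances `…_of_minCircuit_fibres`, `…_of_exitVertex_fibres`,
  `…_of_exitIndex_fibres`, `…_of_stoppedInvasion_fibres`): to prove `U ↦ Q (f U) U` measurable for a measurable map `f`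
  into a countable set it suffices to do it for each FIXED value of `f` — the form in which the piece decomposition
  `σ = (Γ₀, z₀, w₀, flag)` of Lemma 4.1 is summed;
* `measurable_minCircuit_eq/_prop` (the minimal circuit of `η_p(U)` is a measurable function of `U`, via the locality
  `minCircuit_local`), **`measurable_minCircuit_stoppedInvasions_prop`** (every event of the triple is measurable),
  `measurable_cfgZ/_cfgZW`, `measurable_reachable_cfgZ` (Step 2's test read in `cfgZ` is a measurable event);
* LOCALITY IN THE BOX: `infinite_slab`, `exists_not_subset_invasion_slab` (the invasion leaves every finite set, so the
  break-out data are well defined), `invasion_congr_box`, `exitIndex_congr_box`, `exitVertex_congr_box`,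
  `stoppedInvasion_congr_box`, `minCircuit_congr_box` — agreement of two label fields on the pairs over `B̄_M` fixes the
  invasion history up to the break-out of any `Λ` over `B̄_{M-1}`, and `Γ_min` of `Ā_{r,N}`, `N ≤ M`;
* **`determined_minCircuit_stoppedInvasions`** and **`exists_preimage_eq_minCircuit_stoppedInvasions`** — every event of the
  triple is determined by the labels of the pairs over `B̄_M`, hence of the form `{U | (U e)_{e ∈ F} ∈ s}` for any finite
  `F` containing those pairs: the hypothesis `hZ` of the renewal step `NTW17.ae_frequently_mem_labelMeasure`.

References: C. M. Newman, V. Tassion, W. Wu, *Critical percolation and the minimal spanning tree in slabs*, CPAM 70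
(2017), arXiv:1512.09107, §4 (proof of Thm 2.4, p. 19; Lemma 4.1, pp. 20–21) [NewmanTassionWu2017]; J. T. Chayes,
L. Chayes, C. M. Newman, CMP 101 (1985) §3 (locality of the break-out event) [ChayesChayesNewman1985].
-/

noncomputable section

open MeasureTheory
open Literature.Probability.Percolation Literature.Probability.Percolation.NTW17
open Literature.Probability.Percolation.Invasion

/-! ## Fibre lemmas (generic) -/

namespace Summit.CriticalPhenomena.PercolationContinuityZ3.Theorems.Rsw3

section Fibres

variable {X : Type*} [MeasurableSpace X]

/-- **Fibre lemma.** If `f : X → ι` has countably many values, each fibre `{f = i}` is measurable, and `x ↦ Q i x` is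
measurable for every fixed `i`, then `x ↦ Q (f x) x` is measurable. [folklore] -/
theorem measurable_of_fibres {ι : Type*} [Countable ι] {f : X → ι} (hf : ∀ i, Measurable fun x => f x = i)
    (Q : ι → X → Prop) (hQ : ∀ i, Measurable fun x => Q i x) : Measurable fun x => Q (f x) x := by
  have : (fun x => Q (f x) x) = fun x => ∃ i, f x = i ∧ Q i x := by
    ext x
    exact ⟨fun h => ⟨_, rfl, h⟩, fun ⟨i, hi, h⟩ => hi ▸ h⟩
  rw [this]
  exact Measurable.exists fun i => (hf i).and (hQ i)

variable {V : Type*} [DecidableEq V] {G : SimpleGraph V} [G.LocallyFinite] [Countable V]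

/-- Fibres over the break-out vertex: `U ↦ Q (exitVertex U) U` is measurable once it is for each fixed vertex.
[cite: ChayesChayesNewman1985, §3 proof of Thm 3.2 (the events {break-out at s})] -/
theorem measurable_of_exitVertex_fibres (o : V) (Λ : Finset V) (Q : V → (Sym2 V → ℝ) → Prop)
    (hQ : ∀ s, Measurable fun U => Q s U) :
    Measurable fun U : Sym2 V → ℝ => Q (exitVertex G U o Λ) U :=
  measurable_of_fibres (fun s => measurable_exitVertex_eq o Λ s) Q hQ

/-- Fibres over the break-out time. [cite: ChayesChayesNewman1985, §3 proof of Thm 3.2] -/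
theorem measurable_of_exitIndex_fibres (o : V) (Λ : Finset V) (Q : ℕ → (Sym2 V → ℝ) → Prop)
    (hQ : ∀ n, Measurable fun U => Q n U) :
    Measurable fun U : Sym2 V → ℝ => Q (exitIndex G U o Λ) U :=
  measurable_of_fibres (fun n => measurable_exitIndex_eq o Λ n) Q hQ

/-- Fibres over the invaded region at a fixed time. [cite: ChayesChayesNewman1985, §2 (the model)] -/
theorem measurable_of_invasion_fibres (o : V) (n : ℕ) (Q : Finset V → (Sym2 V → ℝ) → Prop)
    (hQ : ∀ J, Measurable fun U => Q J U) :
    Measurable fun U : Sym2 V → ℝ => Q (invasion G U o n) U :=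
  measurable_of_fibres (fun J => measurable_invasion_eq o n J) Q hQ

/-- Fibres over the STOPPED invasion `I_{n_Λ}`. [cite: NewmanTassionWu2017, §4 (p. 19: 𝓘_x^m)] -/
theorem measurable_of_stoppedInvasion_fibres (o : V) (Λ : Finset V) (Q : Finset V → (Sym2 V → ℝ) → Prop)
    (hQ : ∀ J, Measurable fun U => Q J U) :
    Measurable fun U : Sym2 V → ℝ => Q (invasion G U o (exitIndex G U o Λ)) U :=
  measurable_of_fibres (fun J => measurable_stoppedInvasion_prop o Λ (· = J)) Q hQ

end Fibres

end Summit.CriticalPhenomena.PercolationContinuityZ3.Theorems.Rsw3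

namespace Summit.CriticalPhenomena.PercolationContinuityZ3.Theorems.Crossing

open Summit.CriticalPhenomena.PercolationContinuityZ3.Theorems.Rsw3

variable {k : ℕ}

/-! ## The minimal circuit and the surgered configurations are measurable functions of the labels -/

section MinCircuit

/-- Every property of `Γ_min` of `Ā_{r,N}(c)` is a local event (determined by the pairs over `B̄_N(c)`).
[cite: NewmanTassionWu2017, Theorem 3.8 ("measurable with respect to the edge variables")] -/
theorem determinedBy_minCircuit_prop (P : List (slab 3 k) → Prop) (c : ℤ × ℤ) (r N : ℕ) :
    DeterminedBy {ω : BondConfig (slab 3 k) | P (minCircuit k ω c r N)} (Set.sym2 (slabLift k (sqBox c N))) := by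
  rw [determinedBy_iff]
  intro ω ω' h
  simp only [Set.mem_setOf_eq, minCircuit_local h]

/-- Every property of `Γ_min` defines a measurable event of configurations. [cite: NewmanTassionWu2017, Theorem 3.8] -/
theorem measurableSet_minCircuit_prop (P : List (slab 3 k) → Prop) (c : ℤ × ℤ) (r N : ℕ) :
    MeasurableSet {ω : BondConfig (slab 3 k) | P (minCircuit k ω c r N)} :=
  measurableSet_of_isLocalEvent_holds ⟨(finite_sym2 (slabLift_finite k (sqBox_finite c N))).toFinset, by
    rw [Set.Finite.coe_toFinset]; exact determinedBy_minCircuit_prop P c r N⟩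

/-- **`Γ_min(η_p(U))` is a measurable function of the labels**: every property of it is a measurable event.
[cite: NewmanTassionWu2017, §4 proof of Lemma 4.1 (the pieces indexed by Γ_min)] -/
theorem measurable_minCircuit_prop (p : ℝ) (P : List (slab 3 k) → Prop) (c : ℤ × ℤ) (r N : ℕ) :
    Measurable fun U : Sym2 (slab 3 k) → ℝ => P (minCircuit k (configOfLabels p U (slabGraph 3 k)) c r N) :=
  measurableSet_setOf.1 ((measurableSet_minCircuit_prop P c r N).preimage (measurable_configOfLabels p _))

/-- The fibres `{Γ_min(η_p(U)) = Γ₀}` are measurable. [cite: NewmanTassionWu2017, §4 proof of Lemma 4.1] -/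
theorem measurable_minCircuit_eq (p : ℝ) (c : ℤ × ℤ) (r N : ℕ) (Γ₀ : List (slab 3 k)) :
    Measurable fun U : Sym2 (slab 3 k) → ℝ => minCircuit k (configOfLabels p U (slabGraph 3 k)) c r N = Γ₀ :=
  measurable_minCircuit_prop p (· = Γ₀) c r N

/-- **Fibres over `Γ_min`**: `U ↦ Q (Γ_min(η_p U)) U` is measurable once it is for each fixed circuit `Γ₀` (there are
countably many). [cite: NewmanTassionWu2017, §4 proof of Lemma 4.1 (sum over the pieces)] -/
theorem measurable_of_minCircuit_fibres (p : ℝ) (c : ℤ × ℤ) (r N : ℕ)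
    (Q : List (slab 3 k) → (Sym2 (slab 3 k) → ℝ) → Prop) (hQ : ∀ Γ₀, Measurable fun U => Q Γ₀ U) :
    Measurable fun U : Sym2 (slab 3 k) → ℝ => Q (minCircuit k (configOfLabels p U (slabGraph 3 k)) c r N) U :=
  measurable_of_fibres (fun Γ₀ => measurable_minCircuit_eq p c r N Γ₀) Q hQ

/-- **Every event of the triple `(Γ_min, 𝓘_o^Λ, 𝓘_x^{Λ'})` is measurable** (in particular `𝓑_0^m ∩ 𝓑_x^m ∩ C`).
[cite: NewmanTassionWu2017, §4 (p. 19: 𝓩^i = 𝓑_0^{m_i} ∩ 𝓑_x^{m_i} ∩ C_{n_i,2n_i})] -/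
theorem measurable_minCircuit_stoppedInvasions_prop (p : ℝ) (c : ℤ × ℤ) (r N : ℕ) (o x : slab 3 k)
    (Λ Λ' : Finset (slab 3 k)) (P : List (slab 3 k) → Finset (slab 3 k) → Finset (slab 3 k) → Prop) :
    Measurable fun U : Sym2 (slab 3 k) → ℝ =>
      P (minCircuit k (configOfLabels p U (slabGraph 3 k)) c r N)
        (invasion (slabGraph 3 k) U o (exitIndex (slabGraph 3 k) U o Λ))
        (invasion (slabGraph 3 k) U x (exitIndex (slabGraph 3 k) U x Λ')) := by
  refine measurable_of_minCircuit_fibres p c r N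
    (fun Γ₀ U => P Γ₀ (invasion (slabGraph 3 k) U o (exitIndex (slabGraph 3 k) U o Λ))
      (invasion (slabGraph 3 k) U x (exitIndex (slabGraph 3 k) U x Λ'))) fun Γ₀ => ?_
  refine measurable_of_stoppedInvasion_fibres (G := slabGraph 3 k) o Λ
    (fun J U => P Γ₀ J (invasion (slabGraph 3 k) U x (exitIndex (slabGraph 3 k) U x Λ'))) fun J => ?_
  exact measurable_of_stoppedInvasion_fibres (G := slabGraph 3 k) x Λ' (fun J' _ => P Γ₀ J J')
    fun _ => measurable_const

/-- A configuration map of the form `ω ↦ (ω ∖ S) ∪ L` is measurable. [folklore] -/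
theorem measurable_sdiff_union_const {V : Type*} (S L : Set (Sym2 V)) :
    Measurable fun ω : BondConfig V => (ω \ S) ∪ L := by
  refine measurable_set_iff.2 fun e => ?_
  have : (fun ω : BondConfig V => e ∈ (ω \ S) ∪ L) = fun ω => (e ∈ ω ∧ e ∉ S) ∨ e ∈ L := by
    ext ω; simp [Set.mem_union]
  rw [this]
  exact ((measurable_set_mem e).and measurable_const).or measurable_const

/-- The surgered configuration `cfgZ` (Steps 1 and 3) depends measurably on `ω`. [cite: NewmanTassionWu2017, §4.1 (Steps 1 and 3)] -/
theorem measurable_cfgZ (Γ : List (slab 3 k)) (z : slab 3 k) :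
    Measurable fun ω : BondConfig (slab 3 k) => cfgZ k ω Γ z :=
  measurable_sdiff_union_const _ _

/-- The surgered configuration `cfgZW` (Steps 1–3) depends measurably on `ω`. [cite: NewmanTassionWu2017, §4.1 (Steps 1–3)] -/
theorem measurable_cfgZW (Γ : List (slab 3 k)) (z w : slab 3 k) :
    Measurable fun ω : BondConfig (slab 3 k) => cfgZW k ω Γ z w := by
  have : (fun ω : BondConfig (slab 3 k) => cfgZW k ω Γ z w) =
      (fun ω : BondConfig (slab 3 k) => (ω \ ∅) ∪ edgesOf (gammaW k Γ z w)) ∘ fun ω => cfgZ k ω Γ z := by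
    ext ω e; simp [cfgZW]
  rw [this]
  exact (measurable_sdiff_union_const _ _).comp (measurable_cfgZ Γ z)

/-- **Step 2's test is a measurable event**: for fixed `Γ₀, z₀, w₀, g`, "`w₀` is joined to `g` in `cfgZ(η_p(U))`" is
measurable in `U`. [cite: NewmanTassionWu2017, §4.1 (Step 2: "If w ∈ C_{p_c}(z)")] -/
theorem measurable_reachable_cfgZ (p : ℝ) (Γ₀ : List (slab 3 k)) (z₀ w₀ g : slab 3 k) :
    Measurable fun U : Sym2 (slab 3 k) → ℝ =>
      (openGraph (cfgZ k (configOfLabels p U (slabGraph 3 k)) Γ₀ z₀)).Reachable w₀ g := by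
  have hmeas : Measurable fun U : Sym2 (slab 3 k) → ℝ => cfgZ k (configOfLabels p U (slabGraph 3 k)) Γ₀ z₀ :=
    (measurable_cfgZ Γ₀ z₀).comp (measurable_configOfLabels p _)
  exact measurableSet_setOf.1 ((measurableSet_openConn_holds w₀ g).preimage hmeas)

/-- Reachability in a configuration of the form `(η_p(U) ∖ S) ∪ L` is a measurable event (the recovery form of the
test, read in `η(ω′) ∖ E(Γ_w)`). [cite: NewmanTassionWu2017, §4.1 (Step 2)] -/
theorem measurable_reachable_sdiff_union (p : ℝ) (S L : Set (Sym2 (slab 3 k))) (a b : slab 3 k) :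
    Measurable fun U : Sym2 (slab 3 k) → ℝ =>
      (openGraph ((configOfLabels p U (slabGraph 3 k) \ S) ∪ L)).Reachable a b :=
  measurableSet_setOf.1 ((measurableSet_openConn_holds a b).preimage
    ((measurable_sdiff_union_const S L).comp (measurable_configOfLabels p _)))

end MinCircuit

/-! ## Locality in the box: agreement on the pairs over `B̄_M` -/

section Box

/-- The slab `S_k` is infinite (the base layer is a copy of `ℤ²`). [folklore] -/
theorem infinite_slab (k : ℕ) : Infinite (slab 3 k) :=
  Infinite.of_injective (baseVertex k) fun z w h => by simpa using congrArg (planar k) h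

/-- Every vertex of the slab lies over some box `B̄_m`. [folklore] -/
theorem exists_planar_mem_sqBox (x y : slab 3 k) : ∃ m : ℕ, planar k x ∈ sqBox 0 m ∧ planar k y ∈ sqBox 0 m := by
  refine ⟨(|(planar k x).1| + |(planar k x).2| + |(planar k y).1| + |(planar k y).2|).toNat, ?_, ?_⟩ <;>
  · simp only [sqBox, Set.mem_setOf_eq, Prod.fst_zero, Prod.snd_zero, sub_zero]
    have h0 := Int.self_le_toNat (|(planar k x).1| + |(planar k x).2| + |(planar k y).1| + |(planar k y).2|)
    have h1 := abs_nonneg (planar k x).1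
    have h2 := abs_nonneg (planar k x).2
    have h3 := abs_nonneg (planar k y).1
    have h4 := abs_nonneg (planar k y).2
    constructor <;> linarith

/-- The slab graph `S_k` is preconnected (any two vertices are joined through the base vertex over `0` inside a
column box). [folklore] -/
theorem slabGraph_three_preconnected (k : ℕ) : (slabGraph 3 k).Preconnected := by
  intro x y
  obtain ⟨m, hx, hy⟩ := exists_planar_mem_sqBox x y
  have hreach : ∀ a : slab 3 k, planar k a ∈ sqBox 0 m → (slabGraph 3 k).Reachable (baseVertex k 0) a := by
    intro a ha
    obtain ⟨_, _, hr⟩ := edgeSet_openConnIn_of_mem k (m := m) (a := a) ha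
    have hr' : (openGraph (slabGraph 3 k).edgeSet).Reachable (baseVertex k 0) a :=
      hr.map (SimpleGraph.Embedding.induce _).toHom
    rwa [openGraph, SimpleGraph.fromEdgeSet_edgeSet] at hr'
  exact (hreach x hx).symm.trans (hreach y hy)

/-- **The invasion of the slab leaves every finite set** (so break-out times and vertices are well defined for every
label field). [cite: ChayesChayesNewman1985, §2 (the model)] -/
theorem exists_not_subset_invasion_slab (U : Sym2 (slab 3 k) → ℝ) (o : slab 3 k) (Λ : Finset (slab 3 k)) :
    ∃ n, ¬ invasion (slabGraph 3 k) U o n ⊆ Λ := by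
  haveI := infinite_slab k
  exact Rsw3.exists_not_subset_invasion (slabGraph_three_preconnected k) U o Λ

/-- Agreement on the pairs over `B̄_M` gives agreement on the slab edges touching any `Λ` over `B̄_{M'}`, `M' + 1 ≤ M`
(a slab neighbour of a vertex over `B̄_{M'}` lies over `B̄_{M'+1}`). [folklore] -/
theorem agree_adj_of_agree_box {M M' : ℕ} (hM : M' + 1 ≤ M) {Λ : Finset (slab 3 k)}
    (hΛ : ∀ v ∈ Λ, planar k v ∈ sqBox 0 M') {U U' : Sym2 (slab 3 k) → ℝ}
    (h : ∀ e : Sym2 (slab 3 k), (∀ v ∈ e, planar k v ∈ sqBox 0 M) → U e = U' e) :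
    ∀ x ∈ Λ, ∀ y, (slabGraph 3 k).Adj x y → U s(x, y) = U' s(x, y) := by
  intro x hx y hxy
  refine h _ fun v hv => ?_
  have hx' : planar k x ∈ sqBox 0 M := sqBox_mono 0 (by omega) (hΛ x hx)
  have hy' : planar k y ∈ sqBox 0 M :=
    sqBox_mono 0 hM (mem_slabLift_sqBox_succ_of_adj k hxy (hΛ x hx))
  rcases Sym2.mem_iff.1 hv with rfl | rfl
  · exact hx'
  · exact hy'

variable {M M' : ℕ} {Λ : Finset (slab 3 k)} {U U' : Sym2 (slab 3 k) → ℝ} {o : slab 3 k}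

/-- **Locality of the invasion history in the box**: agreement on the pairs over `B̄_M` fixes `I_n` for `n ≤ n_Λ`,
`Λ` over `B̄_{M-1}`. [cite: ChayesChayesNewman1985, §3 proof of Thm 3.2] -/
theorem invasion_congr_box (hM : M' + 1 ≤ M) (hΛ : ∀ v ∈ Λ, planar k v ∈ sqBox 0 M')
    (h : ∀ e : Sym2 (slab 3 k), (∀ v ∈ e, planar k v ∈ sqBox 0 M) → U e = U' e) {n : ℕ}
    (hn : n ≤ exitIndex (slabGraph 3 k) U o Λ) :
    invasion (slabGraph 3 k) U o n = invasion (slabGraph 3 k) U' o n :=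
  Rsw3.invasion_congr_of_agree_adj (exists_not_subset_invasion_slab U o Λ) (agree_adj_of_agree_box hM hΛ h) hn

/-- Locality of the break-out time in the box. [cite: ChayesChayesNewman1985, §3 proof of Thm 3.2] -/
theorem exitIndex_congr_box (hM : M' + 1 ≤ M) (hΛ : ∀ v ∈ Λ, planar k v ∈ sqBox 0 M')
    (h : ∀ e : Sym2 (slab 3 k), (∀ v ∈ e, planar k v ∈ sqBox 0 M) → U e = U' e) :
    exitIndex (slabGraph 3 k) U' o Λ = exitIndex (slabGraph 3 k) U o Λ :=
  Rsw3.exitIndex_congr_of_agree_adj (exists_not_subset_invasion_slab U o Λ) (agree_adj_of_agree_box hM hΛ h)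

/-- Locality of the break-out vertex in the box (`o ∈ Λ`). [cite: ChayesChayesNewman1985, §3 proof of Thm 3.2] -/
theorem exitVertex_congr_box (ho : o ∈ Λ) (hM : M' + 1 ≤ M) (hΛ : ∀ v ∈ Λ, planar k v ∈ sqBox 0 M')
    (h : ∀ e : Sym2 (slab 3 k), (∀ v ∈ e, planar k v ∈ sqBox 0 M) → U e = U' e) :
    exitVertex (slabGraph 3 k) U' o Λ = exitVertex (slabGraph 3 k) U o Λ :=
  Rsw3.exitVertex_congr_of_agree_adj ho (exists_not_subset_invasion_slab U o Λ) (agree_adj_of_agree_box hM hΛ h)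

/-- **Locality of the stopped invasion `𝓘^Λ` in the box.** [cite: NewmanTassionWu2017, §4 (p. 19: 𝓩 measurable w.r.t. the edges in B̄_m)] -/
theorem stoppedInvasion_congr_box (hM : M' + 1 ≤ M) (hΛ : ∀ v ∈ Λ, planar k v ∈ sqBox 0 M')
    (h : ∀ e : Sym2 (slab 3 k), (∀ v ∈ e, planar k v ∈ sqBox 0 M) → U e = U' e) :
    invasion (slabGraph 3 k) U' o (exitIndex (slabGraph 3 k) U' o Λ) =
      invasion (slabGraph 3 k) U o (exitIndex (slabGraph 3 k) U o Λ) :=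
  Rsw3.invasion_exitIndex_congr_of_agree_adj (exists_not_subset_invasion_slab U o Λ)
    (agree_adj_of_agree_box hM hΛ h)

/-- **Locality of `Γ_min` in the box**: agreement on the pairs over `B̄_M ⊇ B̄_N(c)` fixes `Γ_min(η_p)` of `Ā_{r,N}(c)`.
[cite: NewmanTassionWu2017, Theorem 3.8 ("measurable with respect to the edge variables")] -/
theorem minCircuit_congr_box {c : ℤ × ℤ} {r N : ℕ} (hN : sqBox c N ⊆ sqBox 0 M) (p : ℝ)
    (h : ∀ e : Sym2 (slab 3 k), (∀ v ∈ e, planar k v ∈ sqBox 0 M) → U e = U' e) :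
    minCircuit k (configOfLabels p U (slabGraph 3 k)) c r N =
      minCircuit k (configOfLabels p U' (slabGraph 3 k)) c r N := by
  refine minCircuit_local ?_
  ext e
  simp only [Set.mem_inter_iff, configOfLabels, Set.mem_setOf_eq]
  constructor
  · rintro ⟨⟨hG, hU⟩, hS⟩
    refine ⟨⟨hG, ?_⟩, hS⟩
    rwa [← h e fun v hv => hN (Set.mem_sym2_iff_subset.1 hS hv)]
  · rintro ⟨⟨hG, hU⟩, hS⟩
    refine ⟨⟨hG, ?_⟩, hS⟩
    rwa [h e fun v hv => hN (Set.mem_sym2_iff_subset.1 hS hv)]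

/-- **Every event of the triple `(Γ_min(η_p), 𝓘_o^Λ, 𝓘_x^{Λ'})` is determined by the labels of the pairs over `B̄_M`**
(`B̄_N(c) ⊆ B̄_M`; `Λ, Λ'` over `B̄_{M'}`, `M' + 1 ≤ M`).
[cite: NewmanTassionWu2017, §4 (p. 19: "𝓩^{i-1} is measurable with respect to the state of edges in B̄_{m_{i-1}}")] -/
theorem determined_minCircuit_stoppedInvasions {c : ℤ × ℤ} {r N : ℕ} (hN : sqBox c N ⊆ sqBox 0 M)
    (hM : M' + 1 ≤ M) {Λ Λ' : Finset (slab 3 k)} (hΛ : ∀ v ∈ Λ, planar k v ∈ sqBox 0 M')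
    (hΛ' : ∀ v ∈ Λ', planar k v ∈ sqBox 0 M') (p : ℝ) (o x : slab 3 k)
    (P : List (slab 3 k) → Finset (slab 3 k) → Finset (slab 3 k) → Prop) :
    ∀ U U' : Sym2 (slab 3 k) → ℝ,
      (∀ e : Sym2 (slab 3 k), (∀ v ∈ e, planar k v ∈ sqBox 0 M) → U e = U' e) →
      P (minCircuit k (configOfLabels p U (slabGraph 3 k)) c r N)
          (invasion (slabGraph 3 k) U o (exitIndex (slabGraph 3 k) U o Λ))
          (invasion (slabGraph 3 k) U x (exitIndex (slabGraph 3 k) U x Λ')) →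
        P (minCircuit k (configOfLabels p U' (slabGraph 3 k)) c r N)
          (invasion (slabGraph 3 k) U' o (exitIndex (slabGraph 3 k) U' o Λ))
          (invasion (slabGraph 3 k) U' x (exitIndex (slabGraph 3 k) U' x Λ')) := by
  intro U U' h hP
  rwa [← minCircuit_congr_box hN p h, stoppedInvasion_congr_box hM hΛ h, stoppedInvasion_congr_box hM hΛ' h]

/-- **The `hZ` input of the renewal step**: every event of the triple is of the form `{U | (U e)_{e ∈ F} ∈ s}`, `s`
measurable, for any finite set `F` of pairs containing all pairs over `B̄_M` — `𝓩^i ∈ σ(U_e : e ∈ F_i)`.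
[cite: NewmanTassionWu2017, §4 (p. 19: "𝓩^{i-1} is measurable with respect to the state of edges in B̄_{m_{i-1}}")] -/
theorem exists_preimage_eq_minCircuit_stoppedInvasions {c : ℤ × ℤ} {r N : ℕ} (hN : sqBox c N ⊆ sqBox 0 M)
    (hM : M' + 1 ≤ M) {Λ Λ' : Finset (slab 3 k)} (hΛ : ∀ v ∈ Λ, planar k v ∈ sqBox 0 M')
    (hΛ' : ∀ v ∈ Λ', planar k v ∈ sqBox 0 M') (p : ℝ) (o x : slab 3 k)
    (P : List (slab 3 k) → Finset (slab 3 k) → Finset (slab 3 k) → Prop)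
    (F : Finset (Sym2 (slab 3 k))) (hF : ∀ e : Sym2 (slab 3 k), (∀ v ∈ e, planar k v ∈ sqBox 0 M) → e ∈ F) :
    ∃ s : Set (F → ℝ), MeasurableSet s ∧
      (fun (U : Sym2 (slab 3 k) → ℝ) (e : F) => U e) ⁻¹' s =
        {U | P (minCircuit k (configOfLabels p U (slabGraph 3 k)) c r N)
          (invasion (slabGraph 3 k) U o (exitIndex (slabGraph 3 k) U o Λ))
          (invasion (slabGraph 3 k) U x (exitIndex (slabGraph 3 k) U x Λ'))} :=
  NTW17.exists_preimage_restrict_eq_of_determined F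
    (measurableSet_setOf.2 (measurable_minCircuit_stoppedInvasions_prop p c r N o x Λ Λ' P))
    fun U U' hUU' => determined_minCircuit_stoppedInvasions hN hM hΛ hΛ' p o x P U U'
      fun e he => hUU' e (hF e he)

/-- The specialisation to the finite set of ALL pairs over `B̄_M` (as `F_i` is instantiated in the closer).
[cite: NewmanTassionWu2017, §4 (p. 19)] -/
theorem exists_preimage_eq_minCircuit_stoppedInvasions_box {c : ℤ × ℤ} {r N : ℕ} (hN : sqBox c N ⊆ sqBox 0 M)
    (hM : M' + 1 ≤ M) {Λ Λ' : Finset (slab 3 k)} (hΛ : ∀ v ∈ Λ, planar k v ∈ sqBox 0 M')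
    (hΛ' : ∀ v ∈ Λ', planar k v ∈ sqBox 0 M') (p : ℝ) (o x : slab 3 k)
    (P : List (slab 3 k) → Finset (slab 3 k) → Finset (slab 3 k) → Prop) :
    ∃ s : Set ((finite_sym2 (slabLift_finite k (sqBox_finite (0 : ℤ × ℤ) M))).toFinset → ℝ), MeasurableSet s ∧
      (fun (U : Sym2 (slab 3 k) → ℝ) (e : (finite_sym2 (slabLift_finite k (sqBox_finite (0 : ℤ × ℤ) M))).toFinset) =>
          U e) ⁻¹' s =
        {U | P (minCircuit k (configOfLabels p U (slabGraph 3 k)) c r N)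
          (invasion (slabGraph 3 k) U o (exitIndex (slabGraph 3 k) U o Λ))
          (invasion (slabGraph 3 k) U x (exitIndex (slabGraph 3 k) U x Λ'))} :=
  exists_preimage_eq_minCircuit_stoppedInvasions hN hM hΛ hΛ' p o x P _ fun e he => by
    rw [Set.Finite.mem_toFinset, Set.mem_sym2_iff_subset]
    exact fun v hv => he v hv

end Box

end Summit.CriticalPhenomena.PercolationContinuityZ3.Theorems.Crossing
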